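import Summits.ValiantsHypothesis.ValiantsHypothesis.Theorems.SymPencilPerFourRowForms

/-!
# Route `SymPencil` — the Lie stabiliser of `per [v; ·]` in `gl₁₂` is the traceless row scalings
# (tool file for the one-row cells `(12,4,0)` / `(12,4,1)` of `sdc(per_4)`, `--supports`
# stmt-ValiantsHypothesis-5674; nothing here bears on `VP ≠ VNP`)

Fix `v ∈ K⁴` with ALL coordinates non-zero and consider the cubic form on `3 × 4` matrices
`x = (x₀, x₁, x₂)` (rows)

  `F_v(x) = per [v; x₀; x₁; x₂]`        (the `4 × 4` permanent with first row `v`).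

**Theorem** (`rowScaling_of_deriv_vanish`).  If a linear map `X` of the space of `3 × 4`
matrices satisfies `DF_v(x)[X x] = 0` for all `x`, i.e.
`Σ_a per [v; x with row a replaced by (X x)_a] = 0`, then `X` is a TRACELESS ROW SCALING:
`(X x)_a = α_a x_a` with `α₀ + α₁ + α₂ = 0`.

Proof (all by evaluation at coordinate vectors, `2 ≠ 0`): write `F_v(x) = T(x₀,x₁,x₂)` with `T`
trilinear and symmetric.  (1) Testing at matrices with one zero row and rescaling a row separates
the identity by multidegree: each off-diagonal block `X_{ab}` satisfies `T(X_{ab} y, y, z) = 0`,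
and the diagonal blocks satisfy `T(X₀₀a,b,c) + T(a,X₁₁b,c) + T(a,b,X₂₂c) = 0`.
(2) `T(w, e_i, e_c) = v_p w_q + v_q w_p` (`{p,q}` the complement of `{i,c}`), so
`T(w, e_i, ·) = 0` forces `w ∈ K e_i` (`eq_zero_of_perm_single`, a `3 × 3` system of determinant
`-2 v_p v_q v_r`); with the polarisation `T(Ye_i,e_k,e_c) + T(Ye_k,e_i,e_c) = (η_i+η_k) v_o` this
kills every `Y` with `T(Yy,y,z) ≡ 0` (`eq_zero_of_perm_quad`).  (3) For the diagonal blocks,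
`T((X₀₀+X₁₁)e_i, e_i, ·) = 0` etc. make each `X_aa` diagonal, and `T(e_p,e_q,e_r) = v_s` turns the
identity into `ξ_{0p} + ξ_{1q} + ξ_{2r} = 0` for all distinct `p,q,r`, whence `ξ_{a·}` is constant
in the column and the three constants sum to zero (`diag_of_perm_sum`).

This is the linear-algebra heart of the kill of the one-row kernel cell: there the base-point
identity gives `DF_v(x)[(K(v) - ℓ(v)/3) x] = 0` (`SymPencilPerFourOneRowKernel`).  An exact
computation of val-width-5676-p2 g4 (nullity `8 = 4 × 2` of the `576`-unknown system `NC2a`)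
found the same answer numerically; this file is its proof. [folklore]
-/

noncomputable section

-- single-conjunct layout: Sub = Summit, duplicated namespace component intended
set_option linter.dupNamespace false

namespace Summit.ValiantsHypothesis.ValiantsHypothesis.Theorems.SymPencilPerFourRowStabilizer

open Matrix
open Summit.ValiantsHypothesis.ValiantsHypothesis.Theorems.SymPencilPerFourInnerRankRows
open Summit.ValiantsHypothesis.ValiantsHypothesis.Theorems.SymPencilPerFourRowForms

variable {K : Type*} [Field K] [CharZero K]

/-! ### The three linear-algebra steps -/

/-- **Step (2a).** If `per [v; w; e_i; z] = 0` for every `z` (all `v_j ≠ 0`), then `w ∈ K e_i`.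
[folklore] -/
theorem eq_zero_of_perm_single {v : Fin 4 → K} (hv : ∀ j, v j ≠ 0) (i : Fin 4) (w : Fin 4 → K)
    (h : ∀ z : Fin 4 → K,
      (Matrix.of ![v, w, Pi.single i 1, z]).permanent = 0) :
    ∀ p, p ≠ i → w p = 0 := by
  intro p hp
  obtain ⟨q, r, hiq, hir, hpq, hpr, hqr⟩ := exists_compl_pair i p (Ne.symm hp)
  have A := h (Pi.single q 1)
  have B := h (Pi.single r 1)
  have C := h (Pi.single p 1)
  rw [permanent_rows_single_single v w p i q r ⟨hp, hpq, hpr, hiq, hir, hqr⟩] at A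
  rw [permanent_rows_single_single v w p i r q ⟨hp, hpr, hpq, hir, hiq, hqr.symm⟩] at B
  rw [permanent_rows_single_single v w q i p r ⟨hiq.symm, hpq.symm, hqr, hp.symm, hir, hpr⟩] at C
  have h2 : 2 * v q * v r * w p = 0 := by linear_combination v q * A + v r * B - v p * C
  exact (mul_eq_zero.1 h2).resolve_left (mul_ne_zero (mul_ne_zero two_ne_zero (hv q)) (hv r))

/-- **Step (2b).** A linear map `Y` with `per [v; Y y; y; z] = 0` for all `y, z` (all `v_j ≠ 0`)
vanishes. [folklore] -/
theorem eq_zero_of_perm_quad {v : Fin 4 → K} (hv : ∀ j, v j ≠ 0)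
    (Y : (Fin 4 → K) →ₗ[K] (Fin 4 → K))
    (h : ∀ y z : Fin 4 → K,
      (Matrix.of ![v, Y y, y, z]).permanent = 0) :
    Y = 0 := by
  -- polarisation in `y`
  have hpol : ∀ y y' z : Fin 4 → K,
      (Matrix.of ![v, Y y, y', z]).permanent +
        (Matrix.of ![v, Y y', y, z]).permanent = 0 := by
    intro y y' z
    have h1 := h (y + y') z
    have h2 := h y z
    have h3 := h y' z
    rw [map_add, per_add_row₁, permanent_rows_swap₁₂ v (Y y), per_add_row₁,
      permanent_rows_swap₁₂ v (Y y'), per_add_row₁, permanent_rows_swap₁₂ v y,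
      permanent_rows_swap₁₂ v y', permanent_rows_swap₁₂ v y, permanent_rows_swap₁₂ v y'] at h1
    linear_combination h1 - h2 - h3
  -- each `Y e_i` is a multiple of `e_i`
  have hdiag : ∀ i p, p ≠ i → Y (Pi.single i 1) p = 0 := fun i =>
    eq_zero_of_perm_single hv i (Y (Pi.single i 1)) fun z => h (Pi.single i 1) z
  have hYe : ∀ i, Y (Pi.single i 1) = Y (Pi.single i 1) i • (Pi.single i 1 : Fin 4 → K) :=
    fun i => eq_smul_single_of_apply_eq_zero i _ (hdiag i)
  -- the diagonal entries pair to zero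
  have hpair : ∀ i k, i ≠ k → Y (Pi.single i 1) i + Y (Pi.single k 1) k = 0 := by
    intro i k hik
    obtain ⟨c, o, hic, hio, hkc, hko, hco⟩ := exists_compl_pair i k hik
    have h1 := hpol (Pi.single i 1) (Pi.single k 1) (Pi.single c 1)
    rw [hYe i, hYe k, permanent_rows_smul₁, permanent_rows_smul₁,
      permanent_rows_three_single v i k c o ⟨hik, hic, hio, hkc, hko, hco⟩,
      permanent_rows_three_single v k i c o ⟨hik.symm, hkc, hko, hic, hio, hco⟩] at h1
    have h2 : (Y (Pi.single i 1) i + Y (Pi.single k 1) k) * v o = 0 := by linear_combination h1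
    exact (mul_eq_zero.1 h2).resolve_right (hv o)
  have hη : ∀ i, Y (Pi.single i 1) i = 0 := by
    intro i
    obtain ⟨j, k, hij, hik, hjk⟩ := exists_pair_ne i
    have h1 := hpair i j hij
    have h2 := hpair i k hik
    have h3 := hpair j k hjk
    have h4 : (2 : K) * Y (Pi.single i 1) i = 0 := by linear_combination h1 + h2 - h3
    exact (mul_eq_zero.1 h4).resolve_left two_ne_zero
  apply (Pi.basisFun K (Fin 4)).ext
  intro i
  rw [Pi.basisFun_apply, LinearMap.zero_apply, hYe i, hη i, zero_smul]

/-- **Step (1)+(2b) for a pair of blocks.** If `per [v; Y y + Z z; y; z] = 0` for all `y, z`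
(all `v_j ≠ 0`), then `Y = 0` and `Z = 0`. [folklore] -/
theorem eq_zero_of_perm_pair {v : Fin 4 → K} (hv : ∀ j, v j ≠ 0)
    (Y Z : (Fin 4 → K) →ₗ[K] (Fin 4 → K))
    (h : ∀ y z : Fin 4 → K,
      (Matrix.of ![v, Y y + Z z, y, z]).permanent = 0) :
    Y = 0 ∧ Z = 0 := by
  -- separate the two blocks by rescaling `y`
  have hsep : ∀ y z : Fin 4 → K,
      (Matrix.of ![v, Y y, y, z]).permanent = 0 ∧
      (Matrix.of ![v, Z z, y, z]).permanent = 0 := by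
    intro y z
    have h1 := h y z
    have h2 := h ((2 : K) • y) z
    rw [per_add_row₁] at h1
    rw [map_smul, per_add_row₁, permanent_rows_smul₁, per_smul_row₂,
      per_smul_row₂] at h2
    constructor
    · linear_combination h2 / 2 - h1
    · linear_combination 2 * h1 - h2 / 2
  refine ⟨eq_zero_of_perm_quad hv Y fun y z => (hsep y z).1,
    eq_zero_of_perm_quad hv Z fun z y => ?_⟩
  rw [per_swap_row₂₃]
  exact (hsep y z).2

/-- **Step (3).** If `per [v; Y₀a; b; c] + per [v; a; Y₁b; c] + per [v; a; b; Y₂c] = 0` for all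
`a, b, c` (all `v_j ≠ 0`), then `Y_a = α_a · id` with `α₀ + α₁ + α₂ = 0`. [folklore] -/
theorem diag_of_perm_sum {v : Fin 4 → K} (hv : ∀ j, v j ≠ 0)
    (Y₀ Y₁ Y₂ : (Fin 4 → K) →ₗ[K] (Fin 4 → K))
    (h : ∀ a b c : Fin 4 → K,
      (Matrix.of ![v, Y₀ a, b, c]).permanent +
        (Matrix.of ![v, a, Y₁ b, c]).permanent +
        (Matrix.of ![v, a, b, Y₂ c]).permanent = 0) :
    ∃ α : Fin 3 → K, α 0 + α 1 + α 2 = 0 ∧ (∀ y, Y₀ y = α 0 • y) ∧ (∀ y, Y₁ y = α 1 • y) ∧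
      ∀ y, Y₂ y = α 2 • y := by
  -- pairwise sums are diagonal
  have h01 : ∀ i p, p ≠ i → (Y₀ (Pi.single i 1) + Y₁ (Pi.single i 1)) p = 0 := by
    intro i
    refine eq_zero_of_perm_single hv i _ fun z => ?_
    have h1 := h (Pi.single i 1) (Pi.single i 1) z
    rw [permanent_rows_rep, permanent_rows_swap₁₂ v (Pi.single i 1)] at h1
    rw [per_add_row₁]
    linear_combination h1
  have h02 : ∀ i p, p ≠ i → (Y₀ (Pi.single i 1) + Y₂ (Pi.single i 1)) p = 0 := by
    intro i
    refine eq_zero_of_perm_single hv i _ fun z => ?_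
    have h1 := h (Pi.single i 1) z (Pi.single i 1)
    rw [per_swap_row₂₃ v (Y₀ _), per_swap_row₂₃ v (Pi.single i 1) _ (Y₁ z),
      permanent_rows_swap₁₂ v (Pi.single i 1) (Pi.single i 1), permanent_rows_rep,
      permanent_rows_cycle v (Pi.single i 1) z] at h1
    rw [per_add_row₁]
    linear_combination h1
  have h12 : ∀ i p, p ≠ i → (Y₁ (Pi.single i 1) + Y₂ (Pi.single i 1)) p = 0 := by
    intro i
    refine eq_zero_of_perm_single hv i _ fun z => ?_
    have h1 := h z (Pi.single i 1) (Pi.single i 1)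
    rw [← permanent_rows_cycle v (Pi.single i 1) (Pi.single i 1) (Y₀ z), permanent_rows_rep,
      ← permanent_rows_cycle v (Y₁ _) (Pi.single i 1) z,
      per_swap_row₂₃ v z (Y₂ _) (Pi.single i 1),
      ← permanent_rows_cycle v (Y₂ _) (Pi.single i 1) z] at h1
    rw [per_add_row₁]
    linear_combination h1
  have hd : ∀ i p, p ≠ i →
      Y₀ (Pi.single i 1) p = 0 ∧ Y₁ (Pi.single i 1) p = 0 ∧ Y₂ (Pi.single i 1) p = 0 := by
    intro i p hp
    have a := h01 i p hp
    have b := h02 i p hp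
    have c := h12 i p hp
    simp only [Pi.add_apply] at a b c
    have e0 : (2 : K) * Y₀ (Pi.single i 1) p = 0 := by linear_combination a + b - c
    have e1 : (2 : K) * Y₁ (Pi.single i 1) p = 0 := by linear_combination a + c - b
    have e2 : (2 : K) * Y₂ (Pi.single i 1) p = 0 := by linear_combination b + c - a
    exact ⟨(mul_eq_zero.1 e0).resolve_left two_ne_zero, (mul_eq_zero.1 e1).resolve_left two_ne_zero,
      (mul_eq_zero.1 e2).resolve_left two_ne_zero⟩
  have hYe : ∀ i,
      Y₀ (Pi.single i 1) = Y₀ (Pi.single i 1) i • (Pi.single i 1 : Fin 4 → K) ∧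
      Y₁ (Pi.single i 1) = Y₁ (Pi.single i 1) i • (Pi.single i 1 : Fin 4 → K) ∧
      Y₂ (Pi.single i 1) = Y₂ (Pi.single i 1) i • (Pi.single i 1 : Fin 4 → K) := fun i =>
    ⟨eq_smul_single_of_apply_eq_zero i _ fun p hp => (hd i p hp).1,
      eq_smul_single_of_apply_eq_zero i _ fun p hp => (hd i p hp).2.1,
      eq_smul_single_of_apply_eq_zero i _ fun p hp => (hd i p hp).2.2⟩
  -- the triple relations `ξ₀p + ξ₁q + ξ₂r = 0`
  have htrip : ∀ p q r s : Fin 4, p ≠ q ∧ p ≠ r ∧ p ≠ s ∧ q ≠ r ∧ q ≠ s ∧ r ≠ s →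
      Y₀ (Pi.single p 1) p + Y₁ (Pi.single q 1) q + Y₂ (Pi.single r 1) r = 0 := by
    intro p q r s hd'
    have h1 := h (Pi.single p 1) (Pi.single q 1) (Pi.single r 1)
    rw [(hYe p).1, (hYe q).2.1, (hYe r).2.2, permanent_rows_smul₁, per_smul_row₂,
      per_smul_row₃, permanent_rows_three_single v p q r s hd'] at h1
    have h2 : (Y₀ (Pi.single p 1) p + Y₁ (Pi.single q 1) q + Y₂ (Pi.single r 1) r) * v s = 0 := by
      linear_combination h1
    exact (mul_eq_zero.1 h2).resolve_right (hv s)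
  -- constancy along each row
  have hc0 : ∀ p p', Y₀ (Pi.single p 1) p = Y₀ (Pi.single p' 1) p' := by
    intro p p'
    by_cases hpp : p = p'
    · rw [hpp]
    obtain ⟨q, r, hpq, hpr, hp'q, hp'r, hqr⟩ := exists_compl_pair p p' hpp
    have A := htrip p q r p' ⟨hpq, hpr, hpp, hqr, hp'q.symm, hp'r.symm⟩
    have B := htrip p' q r p ⟨hp'q, hp'r, Ne.symm hpp, hqr, hpq.symm, hpr.symm⟩
    linear_combination A - B
  have hc1 : ∀ q q', Y₁ (Pi.single q 1) q = Y₁ (Pi.single q' 1) q' := by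
    intro q q'
    by_cases hqq : q = q'
    · rw [hqq]
    obtain ⟨p, r, hqp, hqr, hq'p, hq'r, hpr⟩ := exists_compl_pair q q' hqq
    have A := htrip p q r q' ⟨hqp.symm, hpr, hq'p.symm, hqr, hqq, hq'r.symm⟩
    have B := htrip p q' r q ⟨hq'p.symm, hpr, hqp.symm, hq'r, Ne.symm hqq, hqr.symm⟩
    linear_combination A - B
  have hc2 : ∀ r r', Y₂ (Pi.single r 1) r = Y₂ (Pi.single r' 1) r' := by
    intro r r'
    by_cases hrr : r = r'
    · rw [hrr]
    obtain ⟨p, q, hrp, hrq, hr'p, hr'q, hpq⟩ := exists_compl_pair r r' hrr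
    have A := htrip p q r r' ⟨hpq, hrp.symm, hr'p.symm, hrq.symm, hr'q.symm, hrr⟩
    have B := htrip p q r' r ⟨hpq, hr'p.symm, hrp.symm, hr'q.symm, hrq.symm, Ne.symm hrr⟩
    linear_combination A - B
  refine ⟨![Y₀ (Pi.single 0 1) 0, Y₁ (Pi.single 0 1) 0, Y₂ (Pi.single 0 1) 0], ?_, ?_, ?_, ?_⟩
  · have h1 := htrip 0 1 2 3 (by decide)
    simp only [Matrix.cons_val_zero, Matrix.cons_val_one, Matrix.cons_val_two]
    rw [hc1 0 1, hc2 0 2]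
    exact h1
  · exact fun y => apply_eq_smul_of_single Y₀ _ (fun i => by rw [(hYe i).1, hc0 i 0]; rfl) y
  · exact fun y => apply_eq_smul_of_single Y₁ _ (fun i => by rw [(hYe i).2.1, hc1 i 0]; rfl) y
  · exact fun y => apply_eq_smul_of_single Y₂ _ (fun i => by rw [(hYe i).2.2, hc2 i 0]; rfl) y

/-! ### The stabiliser theorem -/

/-- **The Lie stabiliser of `per [v; ·]` in `gl₁₂` is the traceless row scalings** (all
`v_j ≠ 0`, characteristic `0`): if `DF_v(x)[X x] = 0` for all `3 × 4` matrices `x` (rows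
`x 0, x 1, x 2`), then `(X x)_a = α_a x_a` with `Σ α_a = 0`.  See the module docstring.
[folklore] -/
theorem rowScaling_of_deriv_vanish {v : Fin 4 → K} (hv : ∀ j, v j ≠ 0)
    (X : (Fin 3 → Fin 4 → K) →ₗ[K] (Fin 3 → Fin 4 → K))
    (hX : ∀ x : Fin 3 → Fin 4 → K,
      (Matrix.of ![v, X x 0, x 1, x 2]).permanent + (Matrix.of ![v, x 0, X x 1, x 2]).permanent +
        (Matrix.of ![v, x 0, x 1, X x 2]).permanent = 0) :
    ∃ α : Fin 3 → K, ∑ a, α a = 0 ∧ ∀ x a, X x a = α a • x a := by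
  -- the blocks `X_{ab} y = (X (row b := y))_a`
  let Xb : Fin 3 → Fin 3 → (Fin 4 → K) →ₗ[K] (Fin 4 → K) := fun a b =>
    (LinearMap.proj a) ∘ₗ X ∘ₗ (LinearMap.single K (fun _ : Fin 3 => Fin 4 → K) b)
  have hXsum : ∀ x a, X x a = Xb a 0 (x 0) + Xb a 1 (x 1) + Xb a 2 (x 2) := by
    intro x a
    have hx : X x = ∑ b, X (Pi.single b (x b)) := by
      conv_lhs => rw [← Finset.univ_sum_single x]
      rw [map_sum]
    rw [hx, Finset.sum_apply, Fin.sum_univ_three]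
    rfl
  -- the identity at a matrix with rows `a, b, c`
  have hId : ∀ a b c : Fin 4 → K,
      (Matrix.of ![v, Xb 0 0 a + Xb 0 1 b + Xb 0 2 c, b, c]).permanent +
      (Matrix.of ![v, a, Xb 1 0 a + Xb 1 1 b + Xb 1 2 c, c]).permanent +
      (Matrix.of ![v, a, b, Xb 2 0 a + Xb 2 1 b + Xb 2 2 c]).permanent = 0 := by
    intro a b c
    have h1 := hX ![a, b, c]
    simp only [hXsum, Matrix.cons_val_zero, Matrix.cons_val_one, Matrix.cons_val_two] at h1
    exact h1
  -- off-diagonal blocks vanish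
  have hoff0 : Xb 0 1 = 0 ∧ Xb 0 2 = 0 := by
    refine eq_zero_of_perm_pair hv _ _ fun y z => ?_
    have h1 := hId 0 y z
    simp only [map_zero, zero_add, add_zero, permanent_rows_zero₁] at h1
    exact h1
  have hoff1 : Xb 1 0 = 0 ∧ Xb 1 2 = 0 := by
    refine eq_zero_of_perm_pair hv _ _ fun y z => ?_
    have h1 := hId y 0 z
    simp only [map_zero, zero_add, add_zero, per_zero_row₂] at h1
    rwa [permanent_rows_swap₁₂] at h1
  have hoff2 : Xb 2 0 = 0 ∧ Xb 2 1 = 0 := by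
    refine eq_zero_of_perm_pair hv _ _ fun y z => ?_
    have h1 := hId y z 0
    simp only [map_zero, zero_add, add_zero, per_zero_row₃] at h1
    rwa [permanent_rows_cycle] at h1
  -- diagonal blocks are a traceless row scaling
  obtain ⟨α, hα, hY0, hY1, hY2⟩ := diag_of_perm_sum hv (Xb 0 0) (Xb 1 1) (Xb 2 2) fun a b c => by
    have h1 := hId a b c
    simp only [hoff0.1, hoff0.2, hoff1.1, hoff1.2, hoff2.1, hoff2.2, LinearMap.zero_apply,
      add_zero, zero_add] at h1
    exact h1
  refine ⟨α, by rw [Fin.sum_univ_three]; exact hα, fun x a => ?_⟩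
  have h3 : ∀ a : Fin 3, a = 0 ∨ a = 1 ∨ a = 2 := by decide
  rw [hXsum]
  rcases h3 a with rfl | rfl | rfl
  · rw [hY0, hoff0.1, hoff0.2, LinearMap.zero_apply, LinearMap.zero_apply, add_zero, add_zero]
  · rw [hY1, hoff1.1, hoff1.2, LinearMap.zero_apply, LinearMap.zero_apply, zero_add, add_zero]
  · rw [hY2, hoff2.1, hoff2.2, LinearMap.zero_apply, LinearMap.zero_apply, zero_add, zero_add]

end Summit.ValiantsHypothesis.ValiantsHypothesis.Theorems.SymPencilPerFourRowStabilizer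

end
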